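import Mathlib.RingTheory.Regular.RegularSequence
import HarnessLib

/-!
# Weak regularity descends along direct summands (crux `FInjectiveMacaulayfication`, line `Sketch`)

Stub `stub_retractRegular` of the skeleton `Sketch` for crux stmt-ResolutionOfSingularities-15315
(`FrobeniusLadder.FInjectiveMacaulayfication`), cycle 4 "degree-zero descent" package: the
Cohen–Macaulay half of retract descent, companion of E3
`…Theorems.FInjectiveMacaulayfication.Retract.frobeniusClosed_of_retract` (Frobenius-closed half).

Let `A → B` be an algebra admitting an `A`-linear retraction `ρ : B → A` with `ρ 1 = 1` (so
`ρ (algebraMap A B a) = ρ (a • 1) = a`: `A` is a direct summand of `B` as an `A`-module; think of the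
degree-`0` part `T₀ ⊆ T` of a `ℤ`-graded ring). If a list `rs` of elements of `A` becomes a weakly
regular sequence on `B` after applying `algebraMap A B`, then `rs` is a weakly regular sequence on `A`.

Proof. By `RingTheory.Sequence.isWeaklyRegular_map_algebraMap_iff` the hypothesis says that `rs` is
weakly regular on `B` viewed as an `A`-module, and `A` is a retract of that `A`-module via
`Algebra.linearMap A B` and `ρ`. Weak regularity descends to retracts of modules
(`isWeaklyRegular_of_retract`): with `I = (r₁, …, r_{i-1})`, if `rᵢ • x ∈ I • N` then
`rᵢ • ι x ∈ I • M`, so `ι x ∈ I • M` by regularity on `M ⧸ I • M`, and `x = π (ι x) ∈ I • N` because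
`π` is linear (`Submodule.map_smul''`). No Noetherian, injectivity, characteristic or domain
hypothesis is needed. No named facts.

## References

* [BrunsHerzog1998] W. Bruns, J. Herzog, *Cohen–Macaulay rings*, Cambridge Stud. Adv. Math. 39
  (rev. ed. 1998), §1.1 (regular sequences; behaviour under direct summands is folklore).
* [HochsterHuneke1990] M. Hochster, C. Huneke, *Tight closure, invariant theory, and the
  Briançon–Skoda theorem*, J. Amer. Math. Soc. 3 (1990), Prop. 4.12 (the direct-summand pattern).
-/

-- single-problem summit: the doubled namespace component is forced
set_option linter.dupNamespace false

namespace Summit.ResolutionOfSingularities.ResolutionOfSingularities.Theorems.FInjectiveMacaulayfication.RetractRegular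

open RingTheory.Sequence

/-- A linear map `f : M → M'` sends `I • ⊤_M` into `I • ⊤_{M'}`: `f (I • M) = I • f(M) ≤ I • M'`.
[folklore] -/
theorem map_smul_top_le {R M M' : Type*} [CommRing R] [AddCommGroup M] [Module R M]
    [AddCommGroup M'] [Module R M'] (I : Ideal R) (f : M →ₗ[R] M') :
    (I • (⊤ : Submodule R M)).map f ≤ I • (⊤ : Submodule R M') := by
  rw [Submodule.map_smul'']
  exact smul_mono_right I le_top

/-- Regularity of a scalar on `M ⧸ I • M` descends to `N ⧸ I • N` for a retract `N` of `M`
(`ι : N → M`, `π : M → N` linear, `π ∘ ι = id`): if `r • x ∈ I • N` then `r • ι x ∈ I • M`, hence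
`ι x ∈ I • M`, hence `x = π (ι x) ∈ I • N`. [folklore] -/
theorem isSMulRegular_quotient_of_retract {R M N : Type*} [CommRing R] [AddCommGroup M]
    [Module R M] [AddCommGroup N] [Module R N] (ι : N →ₗ[R] M) (π : M →ₗ[R] N)
    (hπι : ∀ x, π (ι x) = x) (I : Ideal R) (r : R)
    (h : IsSMulRegular (M ⧸ (I • ⊤ : Submodule R M)) r) :
    IsSMulRegular (N ⧸ (I • ⊤ : Submodule R N)) r := by
  rw [isSMulRegular_quotient_iff_mem_of_smul_mem] at h ⊢
  intro x hx
  have h1 : ι x ∈ I • (⊤ : Submodule R M) := by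
    refine h (ι x) ?_
    rw [← map_smul]
    exact map_smul_top_le I ι (Submodule.mem_map_of_mem hx)
  have h2 : π (ι x) ∈ I • (⊤ : Submodule R N) := map_smul_top_le I π (Submodule.mem_map_of_mem h1)
  rwa [hπι] at h2

/-- **Weak regularity descends to retracts of modules.** If `N` is a retract of the `R`-module `M`
(`ι : N → M`, `π : M → N` linear with `π ∘ ι = id`) and `rs` is a weakly regular sequence on `M`,
then `rs` is a weakly regular sequence on `N` (apply `isSMulRegular_quotient_of_retract` to each
prefix ideal `(r₁, …, r_{i-1})`). [folklore] -/
theorem isWeaklyRegular_of_retract {R M N : Type*} [CommRing R] [AddCommGroup M] [Module R M]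
    [AddCommGroup N] [Module R N] (ι : N →ₗ[R] M) (π : M →ₗ[R] N) (hπι : ∀ x, π (ι x) = x)
    {rs : List R} (h : IsWeaklyRegular M rs) : IsWeaklyRegular N rs :=
  (isWeaklyRegular_iff_Fin N rs).mpr fun i =>
    isSMulRegular_quotient_of_retract ι π hπι _ _ ((isWeaklyRegular_iff_Fin M rs).mp h i)

/-- **Weak regularity descends along direct summands** (CM half of retract descent, Sketch
`stub_retractRegular`). Along a ring map `A → B` admitting an `A`-linear retraction `ρ : B → A` with
`ρ 1 = 1`, weak regularity of a sequence of elements of `A` descends from `B` to `A`: the mapped list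
is weakly regular on the ring `B` iff `rs` is weakly regular on the `A`-module `B`
(`isWeaklyRegular_map_algebraMap_iff`), and `A` is a retract of that module via `algebraMap` and `ρ`
(`ρ (algebraMap A B a) = ρ (a • 1) = a • ρ 1 = a`), so `isWeaklyRegular_of_retract` applies.
Elementwise: if `rᵢ a ∈ (r_{<i})A` then `rᵢ · a ∈ (r_{<i})B`, so `a ∈ (r_{<i})B` by regularity on `B`,
and `a = ρ (a • 1) ∈ (r_{<i})A`. [folklore] -/
theorem stub_retractRegular : ∀ (A B : Type) [CommRing A] [CommRing B] [Algebra A B] (ρ : B →ₗ[A] A),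
    ρ 1 = 1 → ∀ (rs : List A), RingTheory.Sequence.IsWeaklyRegular B (rs.map (algebraMap A B)) →
      RingTheory.Sequence.IsWeaklyRegular A rs := by
  intro A B _ _ _ ρ hρ rs h
  rw [isWeaklyRegular_map_algebraMap_iff] at h
  refine isWeaklyRegular_of_retract (Algebra.linearMap A B) ρ (fun a => ?_) h
  rw [Algebra.linearMap_apply, Algebra.algebraMap_eq_smul_one, map_smul, hρ, smul_eq_mul, mul_one]

end Summit.ResolutionOfSingularities.ResolutionOfSingularities.Theorems.FInjectiveMacaulayfication.RetractRegular
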